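import Mathlib
import Summits.AtomisticToContinuum.Crystallization.Theses.ReggeStarCoercivity
import Literature.MathematicalPhysics.StatisticalMechanics.LennardJonesClusters
import Summits.AtomisticToContinuum.Crystallization.Theorems.ReggeStarCoercivityLevelOneFrustrationGap

/-!
# `SliverCellsUnbounded` — raw level-1 (single-simplex) scores are unbounded below

Route `ReggeStarCoercivity` of `AtomisticToContinuum/Crystallization`, support item
`stmt-AtomisticToContinuum-13610`: for every `ℓ : ℝ` there is a non-degenerate tetrahedron
`p : Fin 4 → ℝ³` with all six edge lengths in `[1, 2]` whose dihedral-weighted Lennard-Jones edge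
energy `∑_{i<j} (vol(B(pᵢ,1) ∩ W_{ij}) / vol B(pᵢ,1)) · V(|pᵢpⱼ|)` is `< ℓ ·` (the sum of its four
solid-angle fractions `vol(B(pᵢ,1) ∩ Cᵢ) / vol B(pᵢ,1)`), where `W_{ij}` is the dihedral wedge
`pᵢ + ℝ(pⱼ - pᵢ) + cone(pₖ - pᵢ)` and `Cᵢ` the apex cone `pᵢ + cone(pₖ - pᵢ)`.

## Proof (slivers, with crude volume comparisons only)

Witness: the sliver `p = (0,0,0), (1,0,h), (1,1,0), (0,1,h)` with
`h = 1 / (2¹⁷ (1 + |ℓ|))`.  Sides `√(1+h²)`, diagonals `√2`, affinely independent for `h ≠ 0`.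
No exact solid or dihedral angles are needed:

* every edge term is `≤ 0` (`V ≤ 0` on `[1, ∞)`, fractions `≥ 0`);
* the wedge at the diagonal `p₀p₂` contains the coordinate box
  `[-1/2,1/2]² × [1/4,1/2] ⊆ B(p₀,1)` (volume `1/4`) as soon as `h ≤ 1/8`, and
  `V(√2) = -5/256`, so the edge sum is `≤ -(5/1024) / vol B`;
* each apex cone meets `B(pᵢ, 1)` inside the slab `pᵢ + [-1,1]² × [-2h, 2h]` (volume `16h`), so
  the right-hand side is `≥ -64 h |ℓ| / vol B > -(5/1024) / vol B`.

Volumes of coordinate boxes come from `PiLp.volume_preserving_ofLp` and `Real.volume_Icc_pi`;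
the common factor `vol B(·,1) = 4π/3` (`EuclideanSpace.volume_ball_fin_three`) cancels;
`V(√2) = -5/256` is `lennardJones_sqrt_two` of `ReggeStarCoercivityLevelOneFrustrationGap.lean`.
-/

noncomputable section

namespace Summit.AtomisticToContinuum.Crystallization.Theorems

open MeasureTheory Metric WithLp Literature.MathematicalPhysics.StatisticalMechanics
open scoped BigOperators ENNReal

namespace ReggeStarCoercivitySliver

/-! ### Generic pieces: a real-number assembly lemma and coordinate boxes in `ℝ³` -/

/-- Assembly of the final inequality from crude bounds: if all edge terms `T i j` (`i < j`) are
`≤ 0`, the term `T 0 2 ≤ -m`, and the vertex terms satisfy `0 ≤ S i ≤ M` with `4 M |ℓ| < m`,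
then `∑_{i<j} T i j < ℓ ∑ᵢ S i`. -/
theorem sum_Ioi_lt_mul_sum {T : Fin 4 → Fin 4 → ℝ} {S : Fin 4 → ℝ} {ℓ m M : ℝ}
    (hT : ∀ i j, i < j → T i j ≤ 0) (h02 : T 0 2 ≤ -m) (hS0 : ∀ i, 0 ≤ S i)
    (hSM : ∀ i, S i ≤ M) (hℓ : 4 * M * |ℓ| < m) :
    ∑ i, ∑ j ∈ Finset.Ioi i, T i j < ℓ * ∑ i, S i := by
  have hnonpos : ∀ i, ∑ j ∈ Finset.Ioi i, T i j ≤ 0 := fun i =>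
    Finset.sum_nonpos fun j hj => hT i j (Finset.mem_Ioi.1 hj)
  have h1 : ∑ i, ∑ j ∈ Finset.Ioi i, T i j ≤ ∑ j ∈ Finset.Ioi 0, T 0 j := by
    rw [← Finset.add_sum_erase _ _ (Finset.mem_univ (0 : Fin 4))]
    have : ∑ i ∈ Finset.univ.erase (0 : Fin 4), ∑ j ∈ Finset.Ioi i, T i j ≤ 0 :=
      Finset.sum_nonpos fun i _ => hnonpos i
    linarith
  have h2 : ∑ j ∈ Finset.Ioi 0, T 0 j ≤ T 0 2 := by
    have hmem : (2 : Fin 4) ∈ Finset.Ioi 0 := Finset.mem_Ioi.2 (by decide)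
    rw [← Finset.add_sum_erase _ _ hmem]
    have : ∑ j ∈ (Finset.Ioi (0 : Fin 4)).erase 2, T 0 j ≤ 0 :=
      Finset.sum_nonpos fun j hj => hT 0 j (Finset.mem_Ioi.1 (Finset.mem_of_mem_erase hj))
    linarith
  have hM : 0 ≤ M := (hS0 0).trans (hSM 0)
  have hm : 0 < m := lt_of_le_of_lt (by positivity) hℓ
  rcases le_or_gt 0 ℓ with hℓ0 | hℓ0
  · have : 0 ≤ ℓ * ∑ i, S i := mul_nonneg hℓ0 (Finset.sum_nonneg fun i _ => hS0 i)
    linarith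
  · have hsum : ∑ i, S i ≤ 4 * M := by
      calc ∑ i, S i ≤ ∑ _i : Fin 4, M := Finset.sum_le_sum fun i _ => hSM i
        _ = 4 * M := by simp
    have hmul : ℓ * (4 * M) ≤ ℓ * ∑ i, S i := mul_le_mul_of_nonpos_left hsum hℓ0.le
    have habs : |ℓ| = -ℓ := abs_of_neg hℓ0
    rw [habs] at hℓ
    linarith

/-- The volume of a coordinate box `{q | a ≤ q ≤ b coordinatewise}` in `ℝ³`
(as `EuclideanSpace ℝ (Fin 3)`) is `∏ₖ (bₖ - aₖ)`. -/
theorem volume_coordBox (a b : Fin 3 → ℝ) :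
    volume {q : EuclideanSpace ℝ (Fin 3) | ofLp q ∈ Set.Icc a b} =
      ∏ k, ENNReal.ofReal (b k - a k) := by
  rw [← Real.volume_Icc_pi]
  exact (PiLp.volume_preserving_ofLp (Fin 3)).measure_preimage
    measurableSet_Icc.nullMeasurableSet

/-- Real-valued version of `volume_coordBox` for `a ≤ b`. -/
theorem volume_coordBox_toReal {a b : Fin 3 → ℝ} (hab : a ≤ b) :
    (volume {q : EuclideanSpace ℝ (Fin 3) | ofLp q ∈ Set.Icc a b}).toReal = ∏ k, (b k - a k) := by
  rw [volume_coordBox, ENNReal.toReal_prod]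
  exact Finset.prod_congr rfl fun k _ => ENNReal.toReal_ofReal (sub_nonneg.2 (hab k))

/-- A coordinate box has finite volume. -/
theorem volume_coordBox_ne_top (a b : Fin 3 → ℝ) :
    volume {q : EuclideanSpace ℝ (Fin 3) | ofLp q ∈ Set.Icc a b} ≠ ⊤ := by
  rw [volume_coordBox]
  exact ENNReal.prod_ne_top fun _ _ => ENNReal.ofReal_ne_top

/-- The part of a unit ball inside any set has finite volume. -/
theorem volume_ball_inter_ne_top (v : EuclideanSpace ℝ (Fin 3)) (S : Set (EuclideanSpace ℝ (Fin 3))) :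
    volume (ball v 1 ∩ S) ≠ ⊤ :=
  ((measure_mono Set.inter_subset_left).trans_lt measure_ball_lt_top).ne

/-- `vol B(v, 1) = 4π/3` in `ℝ³`. -/
theorem volume_ball_one_toReal (v : EuclideanSpace ℝ (Fin 3)) :
    (volume (ball v (1 : ℝ))).toReal = Real.pi * 4 / 3 := by
  rw [EuclideanSpace.volume_ball_fin_three, ENNReal.ofReal_one, one_pow, one_mul,
    ENNReal.toReal_ofReal (by positivity)]

/-- **Slab bound for an apex cone.**  If every nonnegative combination `∑ cₖ uₖ` whose first two
coordinates are `< 1` in absolute value has third coordinate of absolute value `≤ 2h`, then the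
cone `v + {∑ cₖ uₖ}` meets `B(v, 1)` in volume `≤ 16 h` (it lies in the box
`v + [-1,1]² × [-2h, 2h]`). -/
theorem volume_ball_inter_cone_le (v : EuclideanSpace ℝ (Fin 3))
    (u : Fin 4 → EuclideanSpace ℝ (Fin 3)) {h : ℝ} (hh : 0 ≤ h)
    (H : ∀ c : Fin 4 → ℝ, (∀ k, 0 ≤ c k) → |∑ k, c k * u k 0| < 1 → |∑ k, c k * u k 1| < 1 →
      |∑ k, c k * u k 2| ≤ 2 * h) :
    (volume (ball v 1 ∩ {q : EuclideanSpace ℝ (Fin 3) | ∃ c : Fin 4 → ℝ, (∀ k, 0 ≤ c k) ∧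
      q - v = ∑ k, c k • u k})).toReal ≤ 16 * h := by
  set a : Fin 3 → ℝ := ![v 0 - 1, v 1 - 1, v 2 - 2 * h] with ha
  set b : Fin 3 → ℝ := ![v 0 + 1, v 1 + 1, v 2 + 2 * h] with hb
  have hab : a ≤ b := fun k => by
    fin_cases k <;> simp [ha, hb] <;> linarith
  have hsub : ball v 1 ∩ {q : EuclideanSpace ℝ (Fin 3) | ∃ c : Fin 4 → ℝ, (∀ k, 0 ≤ c k) ∧
      q - v = ∑ k, c k • u k} ⊆ {q | ofLp q ∈ Set.Icc a b} := by
    rintro q ⟨hq, c, hc, hcq⟩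
    rw [mem_ball] at hq
    have hcoord : ∀ m, q m - v m = ∑ k, c k * u k m := by
      intro m
      have := congrArg (fun w : EuclideanSpace ℝ (Fin 3) => w m) hcq
      simpa [Finset.sum_apply] using this
    have hx : |q 0 - v 0| < 1 := by
      have := PiLp.dist_apply_le q v 0
      rw [Real.dist_eq] at this
      linarith
    have hy : |q 1 - v 1| < 1 := by
      have := PiLp.dist_apply_le q v 1
      rw [Real.dist_eq] at this
      linarith
    have hz : |q 2 - v 2| ≤ 2 * h := by
      rw [hcoord 2]
      exact H c hc (hcoord 0 ▸ hx) (hcoord 1 ▸ hy)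
    rw [abs_lt] at hx hy
    rw [abs_le] at hz
    simp only [Set.mem_setOf_eq, Set.mem_Icc]
    refine ⟨fun k => ?_, fun k => ?_⟩
    · fin_cases k <;> simp [ha] <;> linarith
    · fin_cases k <;> simp [hb] <;> linarith
  calc (volume (ball v 1 ∩ {q : EuclideanSpace ℝ (Fin 3) | ∃ c : Fin 4 → ℝ, (∀ k, 0 ≤ c k) ∧
          q - v = ∑ k, c k • u k})).toReal
        ≤ (volume {q : EuclideanSpace ℝ (Fin 3) | ofLp q ∈ Set.Icc a b}).toReal :=
          ENNReal.toReal_mono (volume_coordBox_ne_top a b) (measure_mono hsub)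
    _ = ∏ k, (b k - a k) := volume_coordBox_toReal hab
    _ = 16 * h := by
          simp only [Fin.prod_univ_three, ha, hb, Matrix.cons_val_zero, Matrix.cons_val_one,
            Matrix.cons_val_two, Matrix.head_cons, Matrix.tail_cons]
          ring

/-! ### The sliver `p = (0,0,0), (1,0,h), (1,1,0), (0,1,h)` -/

section Sliver

variable {h : ℝ} (p : Fin 4 → EuclideanSpace ℝ (Fin 3))
  (hp0 : p 0 = toLp 2 ![0, 0, 0]) (hp1 : p 1 = toLp 2 ![1, 0, h])
  (hp2 : p 2 = toLp 2 ![1, 1, 0]) (hp3 : p 3 = toLp 2 ![0, 1, h])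

include hp0 hp1 hp2 hp3

/-- The sliver is a non-degenerate tetrahedron for `h ≠ 0`. -/
theorem sliver_affineIndependent (hh : h ≠ 0) : AffineIndependent ℝ p := by
  have hlin : LinearIndependent ℝ fun j : Fin 3 => p j.succ - p 0 := by
    rw [Fintype.linearIndependent_iff]
    intro g hg j
    have hc : ∀ m : Fin 3, ∑ i, g i * (p i.succ - p 0) m = 0 := by
      intro m
      have := congrArg (fun w : EuclideanSpace ℝ (Fin 3) => w m) hg
      simpa [Finset.sum_apply] using this
    have e0 := hc 0
    have e1 := hc 1
    have e2 := hc 2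
    have h3 : (Fin.succ (2 : Fin 3) : Fin 4) = 3 := rfl
    simp only [Fin.sum_univ_three, Fin.succ_zero_eq_one, Fin.succ_one_eq_two, h3, hp0, hp1, hp2,
      hp3, PiLp.sub_apply, PiLp.toLp_apply, Matrix.cons_val_zero, Matrix.cons_val_one,
      Matrix.cons_val_two, Matrix.head_cons, Matrix.tail_cons] at e0 e1 e2
    have h02 : g 0 + g 2 = 0 := by
      have : (g 0 + g 2) * h = 0 := by linarith
      exact (mul_eq_zero.1 this).resolve_right hh
    fin_cases j <;> simp <;> linarith
  let e : {x : Fin 4 // x ≠ 0} → Fin 3 := fun x => x.1.pred x.2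
  have he : Function.Injective e := fun x y hxy => Subtype.ext (Fin.pred_inj.1 hxy)
  have key : (fun i : {x : Fin 4 // x ≠ 0} => (p i -ᵥ p 0 : EuclideanSpace ℝ (Fin 3))) =
      (fun j : Fin 3 => p j.succ - p 0) ∘ e := by
    funext x
    obtain ⟨x, hx⟩ := x
    obtain ⟨j, rfl⟩ := Fin.exists_succ_eq.2 hx
    simp [e]
  rw [affineIndependent_iff_linearIndependent_vsub ℝ p 0, key]
  exact hlin.comp e he

/-- All six edges of the sliver have length in `[1, 2]` when `0 < h ≤ 1`
(sides `√(1 + h²)`, diagonals `√2`). -/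
theorem sliver_dist (h0 : 0 < h) (h1 : h ≤ 1) :
    ∀ i j : Fin 4, i ≠ j → 1 ≤ dist (p i) (p j) ∧ dist (p i) (p j) ≤ 2 := by
  have key : ∀ x y : EuclideanSpace ℝ (Fin 3), 1 ≤ dist x y ^ 2 → dist x y ^ 2 ≤ 4 →
      1 ≤ dist x y ∧ dist x y ≤ 2 := by
    intro x y h1 h4
    have hd : 0 ≤ dist x y := dist_nonneg
    constructor <;> nlinarith
  have hsq : ∀ x y : EuclideanSpace ℝ (Fin 3),
      dist x y ^ 2 = (x 0 - y 0) ^ 2 + (x 1 - y 1) ^ 2 + (x 2 - y 2) ^ 2 := by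
    intro x y
    rw [EuclideanSpace.dist_eq, Real.sq_sqrt (by positivity), Fin.sum_univ_three]
    simp [Real.dist_eq, sq_abs]
  have hh2 : h ^ 2 ≤ 1 := by nlinarith
  have hh0 : 0 ≤ h ^ 2 := sq_nonneg h
  intro i j hij
  refine key _ _ ?_ ?_ <;> rw [hsq] <;> fin_cases i <;> fin_cases j
  all_goals simp [hp0, hp1, hp2, hp3] at hij ⊢
  all_goals nlinarith

omit hp1 hp3 in
/-- The diagonal `p₀p₂` has length `√2`. -/
theorem sliver_dist_zero_two : dist (p 0) (p 2) = Real.sqrt 2 := by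
  rw [EuclideanSpace.dist_eq, Fin.sum_univ_three]
  simp [hp0, hp2, Real.dist_eq]
  norm_num

/-- **The diagonal wedge is fat.**  For `0 < h ≤ 1/8` the wedge
`p₀ + ℝ(p₂ - p₀) + cone(pₖ - p₀)` at the diagonal `p₀p₂` contains the box
`[-1/2, 1/2]² × [1/4, 1/2] ⊆ B(p₀, 1)`, so it meets the unit ball in volume `≥ 1/4`. -/
theorem quarter_le_volume_wedge (h0 : 0 < h) (h8 : h ≤ 1 / 8) :
    (1 / 4 : ℝ) ≤ (volume (ball (p 0) 1 ∩ {q : EuclideanSpace ℝ (Fin 3) | ∃ s : ℝ,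
      ∃ c : Fin 4 → ℝ, (∀ k, 0 ≤ c k) ∧
        q - p 0 = s • (p 2 - p 0) + ∑ k, c k • (p k - p 0)})).toReal := by
  set a : Fin 3 → ℝ := ![-(1 / 2), -(1 / 2), 1 / 4] with ha
  set b : Fin 3 → ℝ := ![1 / 2, 1 / 2, 1 / 2] with hb
  have hab : a ≤ b := fun k => by
    fin_cases k <;> norm_num [ha, hb]
  have hsub : {q : EuclideanSpace ℝ (Fin 3) | ofLp q ∈ Set.Icc a b} ⊆
      ball (p 0) 1 ∩ {q : EuclideanSpace ℝ (Fin 3) | ∃ s : ℝ, ∃ c : Fin 4 → ℝ, (∀ k, 0 ≤ c k) ∧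
        q - p 0 = s • (p 2 - p 0) + ∑ k, c k • (p k - p 0)} := by
    intro q hq
    simp only [Set.mem_setOf_eq, Set.mem_Icc] at hq
    obtain ⟨hqa, hqb⟩ := hq
    have hx1 := hqa 0
    have hx2 := hqb 0
    have hy1 := hqa 1
    have hy2 := hqb 1
    have hz1 := hqa 2
    have hz2 := hqb 2
    simp only [ha, hb, Matrix.cons_val_zero, Matrix.cons_val_one, Matrix.cons_val_two,
      Matrix.head_cons, Matrix.tail_cons] at hx1 hx2 hy1 hy2 hz1 hz2
    refine ⟨?_, ?_⟩
    · rw [mem_ball, EuclideanSpace.dist_eq, Fin.sum_univ_three]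
      simp only [hp0, PiLp.toLp_apply, Matrix.cons_val_zero, Matrix.cons_val_one,
        Matrix.cons_val_two, Matrix.head_cons, Matrix.tail_cons, Real.dist_eq, sub_zero, sq_abs]
      rw [Real.sqrt_lt' one_pos]
      nlinarith
    · have hzh : 2 ≤ q 2 / h := by
        rw [le_div_iff₀ h0]; nlinarith
      have habs : |q 0 - q 1| ≤ 1 := by
        rw [abs_le]; constructor <;> linarith
      rw [abs_le] at habs
      refine ⟨q 0 - (q 2 / h + (q 0 - q 1)) / 2,
        ![0, (q 2 / h + (q 0 - q 1)) / 2, 0, (q 2 / h - (q 0 - q 1)) / 2], fun k => ?_, ?_⟩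
      · fin_cases k <;> simp <;> linarith
      · ext m
        fin_cases m <;>
          simp [hp0, hp1, hp2, hp3, Fin.sum_univ_four] <;> field_simp <;> ring
  calc (1 / 4 : ℝ) = ∏ k, (b k - a k) := by
        simp only [Fin.prod_univ_three, ha, hb, Matrix.cons_val_zero, Matrix.cons_val_one,
          Matrix.cons_val_two, Matrix.head_cons, Matrix.tail_cons]
        norm_num
    _ = (volume {q : EuclideanSpace ℝ (Fin 3) | ofLp q ∈ Set.Icc a b}).toReal :=
        (volume_coordBox_toReal hab).symm
    _ ≤ _ := ENNReal.toReal_mono (volume_ball_inter_ne_top _ _) (measure_mono hsub)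

/-- **The apex cones are thin.**  For `0 ≤ h` each apex cone `pᵢ + cone(pₖ - pᵢ)` of the
sliver meets `B(pᵢ, 1)` in volume `≤ 16 h`. -/
theorem volume_sliver_cone_le (hh : 0 ≤ h) (i : Fin 4) :
    (volume (ball (p i) 1 ∩ {q : EuclideanSpace ℝ (Fin 3) | ∃ c : Fin 4 → ℝ, (∀ k, 0 ≤ c k) ∧
      q - p i = ∑ k, c k • (p k - p i)})).toReal ≤ 16 * h := by
  refine volume_ball_inter_cone_le (p i) (fun k => p k - p i) hh ?_
  intro c hc hx hy
  have hc0 := hc 0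
  have hc1 := hc 1
  have hc2 := hc 2
  have hc3 := hc 3
  fin_cases i <;>
    simp [Fin.sum_univ_four, hp0, hp1, hp2, hp3] at hx hy ⊢ <;>
    rw [abs_lt] at hx hy <;> rw [abs_le] <;> constructor <;>
    nlinarith [mul_nonneg hh hc0, mul_nonneg hh hc1, mul_nonneg hh hc2, mul_nonneg hh hc3]

/-- **Main estimate for the sliver.**  For `0 < h ≤ 1/8` with `64 h |ℓ| < 5/1024` the sliver
satisfies all three clauses of `SliverCellsUnbounded` at level `ℓ`. -/
theorem sliver_main {ℓ : ℝ} (h0 : 0 < h) (h8 : h ≤ 1 / 8) (hℓ : 64 * h * |ℓ| < 5 / 1024) :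
    AffineIndependent ℝ p ∧ (∀ i j, i ≠ j → 1 ≤ dist (p i) (p j) ∧ dist (p i) (p j) ≤ 2) ∧
    (∑ i : Fin 4, ∑ j ∈ Finset.Ioi i, (volume (Metric.ball (p i) 1 ∩ {q | ∃ s : ℝ,
      ∃ c : Fin 4 → ℝ, (∀ k, 0 ≤ c k) ∧ q - p i = s • (p j - p i) + ∑ k, c k • (p k - p i)})).toReal /
      (volume (Metric.ball (p i) (1 : ℝ))).toReal * lennardJones (dist (p i) (p j))) <
    ℓ * ∑ i : Fin 4, (volume (Metric.ball (p i) 1 ∩ {q | ∃ c : Fin 4 → ℝ, (∀ k, 0 ≤ c k) ∧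
      q - p i = ∑ k, c k • (p k - p i)})).toReal / (volume (Metric.ball (p i) (1 : ℝ))).toReal := by
  have hdist := sliver_dist p hp0 hp1 hp2 hp3 h0 (h8.trans (by norm_num))
  refine ⟨sliver_affineIndependent p hp0 hp1 hp2 hp3 h0.ne', hdist, ?_⟩
  have hB : ∀ v : EuclideanSpace ℝ (Fin 3), (volume (ball v (1 : ℝ))).toReal = Real.pi * 4 / 3 :=
    volume_ball_one_toReal
  have hBpos : 0 < Real.pi * 4 / 3 := by positivity
  simp_rw [hB]
  refine sum_Ioi_lt_mul_sum (m := 5 / 1024 / (Real.pi * 4 / 3)) (M := 16 * h / (Real.pi * 4 / 3))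
    ?_ ?_ ?_ ?_ ?_
  · intro i j hij
    exact mul_nonpos_iff.2 (Or.inl ⟨div_nonneg ENNReal.toReal_nonneg hBpos.le,
      lennardJones_nonpos (hdist i j hij.ne).1⟩)
  · rw [sliver_dist_zero_two p hp0 hp2, lennardJones_sqrt_two]
    have hw := quarter_le_volume_wedge p hp0 hp1 hp2 hp3 h0 h8
    rw [show -(5 / 1024 / (Real.pi * 4 / 3)) = (1 / 4) / (Real.pi * 4 / 3) * (-5 / 256) by ring]
    have : (1 / 4) / (Real.pi * 4 / 3) ≤ _ / (Real.pi * 4 / 3) :=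
      div_le_div_of_nonneg_right hw hBpos.le
    nlinarith
  · intro i
    exact div_nonneg ENNReal.toReal_nonneg hBpos.le
  · intro i
    exact div_le_div_of_nonneg_right (volume_sliver_cone_le p hp0 hp1 hp2 hp3 h0.le i) hBpos.le
  · rw [show 4 * (16 * h / (Real.pi * 4 / 3)) * |ℓ| = (64 * h * |ℓ|) / (Real.pi * 4 / 3) by ring]
    exact div_lt_div_of_pos_right hℓ hBpos

end Sliver

end ReggeStarCoercivitySliver

open ReggeStarCoercivitySliver in
/-- **`SliverCellsUnbounded`** (route `ReggeStarCoercivity`, item `stmt-AtomisticToContinuum-13610`):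
for every `ℓ` there is a non-degenerate tetrahedron with all edges in `[1, 2]` whose
dihedral-weighted Lennard-Jones edge energy is `< ℓ ×` its total solid-angle weight — the
sliver `(0,0,0), (1,0,h), (1,1,0), (0,1,h)` with `h = 1/(2¹⁷(1+|ℓ|))`.  Raw level-1
(single-Delaunay-simplex) cell scores are therefore unbounded below per unit vertex weight. -/
theorem _root_.Summit.AtomisticToContinuum.Crystallization.Theorems.sliverCellsUnbounded_proof :
    Summit.AtomisticToContinuum.Crystallization.Theses.ReggeStarCoercivity.SliverCellsUnbounded := by
  unfold Summit.AtomisticToContinuum.Crystallization.Theses.ReggeStarCoercivity.SliverCellsUnbounded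
  intro ℓ
  have hpos : (0 : ℝ) < 2 ^ 17 * (1 + |ℓ|) := by positivity
  set h : ℝ := 1 / (2 ^ 17 * (1 + |ℓ|)) with hh
  have h0 : 0 < h := one_div_pos.2 hpos
  have h8 : h ≤ 1 / 8 :=
    one_div_le_one_div_of_le (by norm_num) (by nlinarith [abs_nonneg ℓ])
  have hℓ : 64 * h * |ℓ| < 5 / 1024 := by
    rw [hh, show 64 * (1 / (2 ^ 17 * (1 + |ℓ|))) * |ℓ| = 64 * |ℓ| / (2 ^ 17 * (1 + |ℓ|)) by ring,
      div_lt_iff₀ hpos]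
    nlinarith [abs_nonneg ℓ]
  exact ⟨![toLp 2 ![0, 0, 0], toLp 2 ![1, 0, h], toLp 2 ![1, 1, 0], toLp 2 ![0, 1, h]],
    sliver_main _ rfl rfl rfl rfl h0 h8 hℓ⟩

end Summit.AtomisticToContinuum.Crystallization.Theorems

end
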